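import Summits.Ventures.LatticeQCDFlow.TrivializingMaps.WilsonZeroFreeKP
import Summits.Ventures.LatticeQCDFlow.TrivializingMaps.PlaquetteDecorrelation
import Summits.Ventures.LatticeQCDFlow.TrivializingMaps.U1WilsonFisherZero

/-!
HONEST FRAMING: exact (Metropolis-corrected) sampling algorithms for lattice gauge theory; figures
of merit are autocorrelation/cost numbers at stated couplings and volumes; no continuum-physics
claim.

# WilsonFisherZerosAnyGroup — THE FISHER ZEROS OF THE FINITE-VOLUME WILSON PARTITION FUNCTION ARE
# EXTENSIVE FOR EVERY COMPACT GAUGE GROUP, WITH CLOSED-FORM CONSTANTS; `U(1)` (lean-2 GEN-8, ours)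

Venture-side (OURS).  Cell `lqcd-flow` (pub-lqcd), unit `pub-lqcd-lean-2-g8`, 2026-08-22.  Assembly of
three tree files: the abstract extensive-zeros theorem `FisherZerosExtensive.exists_zeros_sum_divisor_ge_centred`
(Blaschke factors + the coefficient Borel–Carathéodory inequality + Mathlib's divisor), the closed-form
volume-uniform zero-free disc `WilsonZeroFreeKP.wilsonZ_zeroFree_explicit` (Kotecký–Preiss disc of the
torus plaquette system, every compact group), and the β = 0 variance
`PlaquetteDecorrelation.variance_wilsonAction_eq_card_mul` (`Var_{D[U]}(S_W^ρ) = #plaq · Var_Haar(Re tr ρ)`).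

* **`wilsonZ_fisherZeros_extensive_anyGroup`** — for `G` compact (second countable), `ρ` a continuous
  unitary-valued `N`-dimensional matrix representation, every `d` and EVERY `L ≥ 2`, every `R > 0`,
  with `r := 1/(4e · max(1, 2N) · (3^d d² + 1)²)` and `v_ρ := Var_Haar(Re tr ρ)`: the partition function
  `Z_L(s) = ∫ D[U] e^{-sS_W^ρ}` has a finite set `T` of zeros `u` with `r ≤ |u| < R`, each of
  multiplicity `divisor Z_L (closedBall 0 (2R)) u ≥ 1`, of total multiplicity at least
  `r² · (v_ρ − 4N/R) · #plaquettes(d, L)` — BOTH constants closed forms in `(d, N, v_ρ)`;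
* **`u1_wilsonZ_fisherZeros_extensive`** — `U(1)` (`v = ½`, `N = 1`, `r = 1/(8e(3^d d² + 1)²)`): at
  least `r² · (½ − 4/R) · #plaq` zeros with `r ≤ |u| < R`, every `L ≥ 2` (e.g. `≥ r²·#plaq/4` in
  `|s| < 16`); `u1_wilsonZ_zeroFree_kp` — none with `|s| ≤ r`, every `L ≥ 1`.

So for the gauge group of the cell's STEP-0 ladder the whole finite-volume Fisher-zero picture of Parts
T17/T21/T22 holds with pure numbers: no zero in `|s| ≤ r(d)`, one in `|s| ≤ 8`, and a number
proportional to the volume in every disc `|s| < R`, `R > 8`.  NOT CLAIMED: optimality of `r`, `8`, or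
the count; `L = 1` for the count; `β ≠ 0`; cost / autocorrelation / continuum statements.  Literature
grade (cell rule): assembly of known mechanisms (strong-coupling analyticity [OsterwalderSeilerAnnPhys1978]
Thm. 3.7, Jensen/Blaschke counting); new typing, no new theorem of physics.
-/

noncomputable section

open MeasureTheory ProbabilityTheory Complex Metric Set Filter Topology MeromorphicOn
open Literature.MathematicalPhysics.QuantumFieldTheory
open Literature.MathematicalPhysics.QuantumFieldTheory.Luscher2010

namespace Summit.Ventures.LatticeQCDFlow.TrivializingMaps

/-! ## §1 Every compact gauge group -/

section AnyGroup

variable {d L N : ℕ} [NeZero L] {G : Type*} [Group G] [TopologicalSpace G] [IsTopologicalGroup G]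
  [CompactSpace G] [MeasurableSpace G] [BorelSpace G] [SecondCountableTopology G]
  (ρ : G →* Matrix (Fin N) (Fin N) ℂ)

/-- The closed-form radius `r(d, N) = 1/(4e · max(1, 2N) · (3^d d² + 1)²)` is positive. [ours] -/
theorem kpRadiusGroup_pos (d N : ℕ) :
    0 < 1 / (4 * Real.exp 1 * max 1 (2 * (N : ℝ)) * ((3 : ℝ) ^ d * (d : ℝ) ^ 2 + 1) ^ 2) := by
  have : (0 : ℝ) < max 1 (2 * (N : ℝ)) := lt_max_of_lt_left one_pos
  positivity

/-- **THE FISHER ZEROS OF `Z_L` ARE EXTENSIVE, EVERY COMPACT GAUGE GROUP, CLOSED-FORM CONSTANTS.**  For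
`G` compact (second countable), `ρ` continuous and unitary-valued, every `d`, every `L ≥ 2` and every
`R > 0`, with `r = 1/(4e·max(1,2N)·(3^d d²+1)²)`: a finite set `T` of zeros `u` of
`Z_L(s) = ∫ D[U] e^{-sS_W^ρ}` with `r ≤ |u| < R`, each of multiplicity `≥ 1` on `closedBall 0 (2R)`, of
total multiplicity at least `r² · (Var_Haar(Re tr ρ) − 4N/R) · #plaquettes`. [ours] -/
theorem wilsonZ_fisherZeros_extensive_anyGroup (hρ : Continuous ρ)
    (hρu : ∀ g, ρ g ∈ Matrix.unitaryGroup (Fin N) ℂ) (hL : 2 ≤ L) (R : ℝ) (hR : 0 < R) :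
    ∃ T : Finset ℂ, (∀ u ∈ T,
        complexMGF (fun U => -wilsonAction ρ U) (trivialMeasure G d L) u = 0 ∧
          1 / (4 * Real.exp 1 * max 1 (2 * (N : ℝ)) * ((3 : ℝ) ^ d * (d : ℝ) ^ 2 + 1) ^ 2) ≤ ‖u‖ ∧
          ‖u‖ < R ∧
          1 ≤ divisor (complexMGF (fun U => -wilsonAction ρ U) (trivialMeasure G d L))
            (closedBall (0 : ℂ) (2 * R)) u) ∧
      (1 / (4 * Real.exp 1 * max 1 (2 * (N : ℝ)) * ((3 : ℝ) ^ d * (d : ℝ) ^ 2 + 1) ^ 2)) ^ 2 *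
          (variance (fun g => (ρ g).trace.re) (haarProbability G) - 4 * N / R) *
          Fintype.card (Plaquette d L) ≤
        ∑ u ∈ T, (divisor (complexMGF (fun U => -wilsonAction ρ U) (trivialMeasure G d L))
            (closedBall (0 : ℂ) (2 * R)) u : ℝ) := by
  set D := trivialMeasure G d L with hD
  haveI : IsProbabilityMeasure D := by rw [hD]; unfold trivialMeasure; infer_instance
  set P : ℝ := (Fintype.card (Plaquette d L) : ℝ) with hPdef
  set r : ℝ := 1 / (4 * Real.exp 1 * max 1 (2 * (N : ℝ)) * ((3 : ℝ) ^ d * (d : ℝ) ^ 2 + 1) ^ 2)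
    with hr
  have hm : AEMeasurable (fun U => -wilsonAction ρ U) D :=
    (WilsonRP.measurable_wilsonAction ρ hρ).neg.aemeasurable
  have hb : ∀ᵐ U ∂D, |(-wilsonAction ρ U) - (-((N : ℝ) * P))| ≤ (N : ℝ) * P :=
    ae_of_all _ fun U => by
      have h0 := WilsonPinching.wilsonAction_nonneg ρ hρ U
      have h1 := WilsonPinching.wilsonAction_le ρ hρ U
      rw [abs_le, hPdef]
      constructor <;> linarith
  have hfree : ∀ z : ℂ, ‖z‖ < r → complexMGF (fun U => -wilsonAction ρ U) D z ≠ 0 :=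
    fun z hz => wilsonZ_zeroFree_explicit (d := d) (L := L) ρ hρ hρu z (by rw [hr] at hz; exact hz.le)
  obtain ⟨T, hT, hsum⟩ :=
    exists_zeros_sum_divisor_ge_centred (μ := D) hm hb hR (kpRadiusGroup_pos d N) hfree
  refine ⟨T, hT, ?_⟩
  have hvar : variance (fun U => -wilsonAction ρ U) D =
      P * variance (fun g => (ρ g).trace.re) (haarProbability G) := by
    rw [variance_fun_neg, hD, hPdef]
    exact variance_wilsonAction_eq_card_mul ρ hρ hL
  rw [hvar, abs_of_nonneg (by positivity)] at hsum
  calc r ^ 2 * (variance (fun g => (ρ g).trace.re) (haarProbability G) - 4 * N / R) * P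
      = r ^ 2 * (P * variance (fun g => (ρ g).trace.re) (haarProbability G) - 4 * (N * P) / R) := by
        ring
    _ ≤ _ := hsum

end AnyGroup

/-! ## §2 `U(1)` -/

section U1

open Literature.MathematicalPhysics.QuantumLattice (u1Rep u1Rep_apply continuous_u1Rep
  u1Rep_mem_unitaryGroup)

variable {d L : ℕ} [NeZero L] [MeasurableSpace Circle] [BorelSpace Circle]

/-- **`U(1)`: no Fisher zero with `|s| ≤ 1/(8e(3^d d² + 1)²)`, every `d`, EVERY `L ≥ 1`.** [ours] -/
theorem u1_wilsonZ_zeroFree_kp (s : ℂ)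
    (hs : ‖s‖ ≤ 1 / (8 * Real.exp 1 * ((3 : ℝ) ^ d * (d : ℝ) ^ 2 + 1) ^ 2)) :
    complexMGF (fun U => -wilsonAction u1Rep U) (trivialMeasure Circle d L) s ≠ 0 := by
  refine wilsonZ_zeroFree_explicit (d := d) (L := L) u1Rep continuous_u1Rep u1Rep_mem_unitaryGroup s ?_
  have hmax : max 1 (2 * ((1 : ℕ) : ℝ)) = 2 := by norm_num
  rw [hmax]
  calc ‖s‖ ≤ 1 / (8 * Real.exp 1 * ((3 : ℝ) ^ d * (d : ℝ) ^ 2 + 1) ^ 2) := hs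
    _ = 1 / (4 * Real.exp 1 * 2 * ((3 : ℝ) ^ d * (d : ℝ) ^ 2 + 1) ^ 2) := by ring

/-- **`U(1)`: THE FISHER ZEROS ARE EXTENSIVE** — for every `d`, every `L ≥ 2`, every `R > 0`, with
`r = 1/(8e(3^d d² + 1)²)`: zeros `u` of the `U(1)` Wilson partition function with `r ≤ |u| < R` of
total multiplicity at least `r² · (½ − 4/R) · #plaquettes`. [ours] -/
theorem u1_wilsonZ_fisherZeros_extensive (hL : 2 ≤ L) (R : ℝ) (hR : 0 < R) :
    ∃ T : Finset ℂ, (∀ u ∈ T,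
        complexMGF (fun U => -wilsonAction u1Rep U) (trivialMeasure Circle d L) u = 0 ∧
          1 / (8 * Real.exp 1 * ((3 : ℝ) ^ d * (d : ℝ) ^ 2 + 1) ^ 2) ≤ ‖u‖ ∧ ‖u‖ < R ∧
          1 ≤ divisor (complexMGF (fun U => -wilsonAction u1Rep U) (trivialMeasure Circle d L))
            (closedBall (0 : ℂ) (2 * R)) u) ∧
      (1 / (8 * Real.exp 1 * ((3 : ℝ) ^ d * (d : ℝ) ^ 2 + 1) ^ 2)) ^ 2 * (1 / 2 - 4 / R) *
          Fintype.card (Plaquette d L) ≤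
        ∑ u ∈ T, (divisor (complexMGF (fun U => -wilsonAction u1Rep U) (trivialMeasure Circle d L))
            (closedBall (0 : ℂ) (2 * R)) u : ℝ) := by
  obtain ⟨T, hT, hsum⟩ := wilsonZ_fisherZeros_extensive_anyGroup (d := d) (L := L) u1Rep
    continuous_u1Rep u1Rep_mem_unitaryGroup hL R hR
  have hr : 1 / (4 * Real.exp 1 * max 1 (2 * ((1 : ℕ) : ℝ)) * ((3 : ℝ) ^ d * (d : ℝ) ^ 2 + 1) ^ 2) =
      1 / (8 * Real.exp 1 * ((3 : ℝ) ^ d * (d : ℝ) ^ 2 + 1) ^ 2) := by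
    have hmax : max 1 (2 * ((1 : ℕ) : ℝ)) = 2 := by norm_num
    rw [hmax]; ring
  refine ⟨T, fun u hu => ?_, ?_⟩
  · obtain ⟨h1, h2, h3, h4⟩ := hT u hu
    exact ⟨h1, hr ▸ h2, h3, h4⟩
  · rw [variance_re_haar_circle, hr] at hsum
    have h4 : (4 : ℝ) * ((1 : ℕ) : ℝ) / R = 4 / R := by norm_num
    rwa [h4] at hsum

end U1

end Summit.Ventures.LatticeQCDFlow.TrivializingMaps
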